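import Literature.MathematicalPhysics.QuantumLattice.GrassmannGaussConvBinomialZone
import HarnessLib

/-!
# Interaction differences that are SMALL AT DEEP PINS and arbitrary near a zone: the FIRST ORDER `e^{Δ_C} D − D` is small at deeper pins
# (binomial–Gram form)

Topic `MathematicalPhysics/QuantumLattice`; the first-order companion of `GrassmannDeepPinGradedLipschitz` (orders `≥ 2`, graded telescoped form) in
the same bookkeeping.  Assembles `GrassmannSupportSplit` (split `D = D_small + D_big` by the support of the monomials: all legs deep / some leg in the
zone), `GrassmannGaussConvBinomialGram.sum_norm_kernel_gaussConv_sub_le_binomial_of_gramBounded` (the binomial–Gram first order, for `D_small`, whose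
UNWEIGHTED profile is globally small) and `GrassmannGaussConvBinomialZone.const_mul_sum_norm_kernel_gaussConv_sub_le_binomial_zone_of_gramBounded`
(the zone form against an admissible constant, for `D_big`, which touches the zone and has only a WEIGHTED profile of the size of the actions).  This is
the linear bracket of one block of the nested two-volume comparison of effective actions in a graded multiscale bookkeeping (Benfatto–Giuliani–
Mastropietro 2006, (2.61)–(2.63), (2.77)–(2.80) with §3; Gawȩdzki–Kupiainen 1985 §3): the fine previous action and the glued coarse one differ by `D`,
whose unweighted pinned profile is `≤ E` at the pins of the deep region `P` and whose `wt`-weighted profile is `≤ N_D` everywhere; at a pin `w` with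
`Λ ≤ wt S` for every `S ∋ w` meeting `Pᶜ`:

* `const_mul_sum_norm_kernel_le_of_zone` — zeroth order: an even `H` all of whose kernels touch a zone `Z` has UNWEIGHTED pinned profile
  `≤ Λ⁻¹ · N^{wt}` at such a pin (`Λ · Σ_{Y : Y_j = w} ‖kernel_{2p} H (Y)‖ ≤ N(p)`);
* **`sum_norm_kernel_gaussConv_sub_le_binomial_of_deep`** —
  `Σ_{W : W_i = w} ‖kernel_{2p} (e^{Δ_C} D − D)(W)‖ ≤ BG_{>p}(E) + Λ⁻¹ · BG_{>p}(N_D)`,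
  `BG_{>p}(N) := Σ_{p < m' ≤ |Γ|/2} C(2m', 2p) κ^{2m'−2p} N(m')` — the right side of the binomial–Gram first-order door, whose kit reading is
  `towerFO` (`…EngineTowerDoorToKitFO.doorBinomial_le_towerFO`).

Everything is proved; no definition, no named fact.

## Sources

G. Benfatto, A. Giuliani, V. Mastropietro, Ann. Henri Poincaré 7 (2006) 809–898, (2.61)–(2.63), (2.77)–(2.80), §3 (3.2)–(3.8)
[`BenfattoGiulianiMastropietro2006`]; K. Gawȩdzki, A. Kupiainen, Comm. Math. Phys. 102 (1985) 1–30, §3 [`GawedzkiKupiainen1985GrossNeveu`].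
-/

noncomputable section

namespace Literature.MathematicalPhysics.QuantumLattice

open GrassmannAlgebra Finset Literature.Probability.LatticeModels Literature.Probability.LatticeModels.BattleFederbush
open scoped Nat

universe u

variable {𝕜 : Type*} [RCLike 𝕜] {Γ : Type u} [Fintype Γ] [DecidableEq Γ] {wt : Finset Γ → ℝ} (C : Matrix Γ Γ 𝕜)

omit [DecidableEq Γ] in
/-- **ZEROTH ORDER: AN INTERACTION TOUCHING A ZONE IS SUPPRESSED AT DEEP PINS.**  If every nonzero kernel of `H` is supported on a label family
meeting `Z`, its `wt`-weighted pinned profile is `≤ N`, and `Λ ≤ wt S` for every `S ∋ w` meeting `Z`, then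
`Λ · Σ_{Y : Y_j = w} ‖kernel_{2p} H (Y)‖ ≤ N(p)` (every contributing family contains `w` and meets `Z`, so its weight is `≥ Λ`).
[cite: BenfattoGiulianiMastropietro2006, §3 (3.2)-(3.8)] -/
theorem const_mul_sum_norm_kernel_le_of_zone [DecidableEq Γ] (H : GrassmannAlgebra 𝕜 Γ) (N : ℕ → ℝ)
    (hN : ∀ m' (j : Fin (2 * m')) (a : Γ), ∑ Y ∈ univ.filter (fun Y : Fin (2 * m') → Γ => Y j = a),
      ‖kernel 𝕜 H (2 * m') Y‖ * wt (univ.image Y) ≤ N m')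
    (Z : Set Γ) (hZ : ∀ (m' : ℕ) (Y : Fin (2 * m') → Γ), kernel 𝕜 H (2 * m') Y ≠ 0 → ∃ j, Y j ∈ Z)
    (w : Γ) {Λ : ℝ} (hΛ : ∀ S : Finset Γ, w ∈ S → (∃ z ∈ S, z ∈ Z) → Λ ≤ wt S)
    {p : ℕ} (j : Fin (2 * p)) :
    Λ * ∑ Y ∈ univ.filter (fun Y : Fin (2 * p) → Γ => Y j = w), ‖kernel 𝕜 H (2 * p) Y‖ ≤ N p := by
  rw [mul_sum]
  refine le_trans (sum_le_sum fun Y hY => ?_) (hN p j w)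
  have hYj : Y j = w := (mem_filter.1 hY).2
  by_cases hk : kernel 𝕜 H (2 * p) Y = 0
  · rw [hk, norm_zero, mul_zero, zero_mul]
  · obtain ⟨j', hj'⟩ := hZ p Y hk
    have hΛY : Λ ≤ wt (univ.image Y) :=
      hΛ _ (mem_image.2 ⟨j, mem_univ _, hYj⟩) ⟨Y j', mem_image.2 ⟨j', mem_univ _, rfl⟩, hj'⟩
    rw [mul_comm]
    exact mul_le_mul_of_nonneg_left hΛY (norm_nonneg _)

/-- **DIFFERENCE SMALL AT DEEP PINS, ARBITRARY NEAR THE ZONE ⇒ THE FIRST ORDER `e^{Δ_C} D − D` IS SMALL AT DEEPER PINS** (binomial–Gram form).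
Replica-Gram-bounded `C` (constant `κ ≥ 0`); a tree weight `wt`; an even `D` with `wt`-weighted pinned profile `N_D` and UNWEIGHTED pinned profile at
most `E` at every pin of the deep region `P`; `0 < Λ ≤ wt S` for every `S ∋ w` meeting `Pᶜ`.  Then in every even degree `2p`, slot `i` pinned at `w`,
`Σ_{W : W_i = w} ‖kernel_{2p} (e^{Δ_C} D − D)(W)‖ ≤ Σ_{p<m'} C(2m',2p) κ^{2m'−2p} E(m') + Λ⁻¹ · Σ_{p<m'} C(2m',2p) κ^{2m'−2p} N_D(m')`
(support split `D = D_s + D_b`: the binomial–Gram door for `D_s`, its zone form for `D_b`).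
[cite: BenfattoGiulianiMastropietro2006, (2.61)-(2.63) and (2.77)-(2.80)] -/
theorem sum_norm_kernel_gaussConv_sub_le_binomial_of_deep (hwt : IsTreeWeight wt) {κ : ℝ} (hκ : 0 ≤ κ) (hGB : IsGramBoundedR C κ)
    (D : GrassmannAlgebra 𝕜 Γ) (hD : D ∈ evenPart 𝕜 Γ) (ND E : ℕ → ℝ) (hND0 : ∀ m', 0 ≤ ND m') (hE0 : ∀ m', 0 ≤ E m')
    (hND : ∀ m' (j : Fin (2 * m')) (x : Γ), ∑ Y ∈ univ.filter (fun Y : Fin (2 * m') → Γ => Y j = x),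
      ‖kernel 𝕜 D (2 * m') Y‖ * wt (univ.image Y) ≤ ND m')
    (P : Γ → Prop) [DecidablePred P]
    (hE : ∀ m' (j : Fin (2 * m')) (x : Γ), P x → ∑ Y ∈ univ.filter (fun Y : Fin (2 * m') → Γ => Y j = x), ‖kernel 𝕜 D (2 * m') Y‖ ≤ E m')
    (w : Γ) {Λ : ℝ} (hΛ0 : 0 < Λ) (hΛ : ∀ S : Finset Γ, w ∈ S → (∃ z ∈ S, ¬ P z) → Λ ≤ wt S)
    {p : ℕ} (i : Fin (2 * p)) :
    ∑ W ∈ univ.filter (fun W : Fin (2 * p) → Γ => W i = w), ‖kernel 𝕜 (gaussConv 𝕜 C D - D) (2 * p) W‖ ≤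
      (∑ m' ∈ range (Fintype.card Γ / 2 + 1), if p < m' then ((2 * m').choose (2 * p) : ℝ) * κ ^ (2 * m' - 2 * p) * E m' else 0) +
        Λ⁻¹ * ∑ m' ∈ range (Fintype.card Γ / 2 + 1), if p < m' then ((2 * m').choose (2 * p) : ℝ) * κ ^ (2 * m' - 2 * p) * ND m' else 0 := by
  -- the support split `D = Ds + Db`
  set Ds : GrassmannAlgebra 𝕜 Γ := supportPart 𝕜 P D with hDs
  set Db : GrassmannAlgebra 𝕜 Γ := D - supportPart 𝕜 P D with hDb
  have hsplit : D = Ds + Db := by rw [hDb, hDs]; abel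
  have hDs_even : Ds ∈ evenPart 𝕜 Γ := supportPart_mem_evenPart 𝕜 P hD
  have hDb_even : Db ∈ evenPart 𝕜 Γ := sub_mem hD hDs_even
  -- the unweighted profile of `Ds` is `≤ E` at EVERY pin (zero outside `P`)
  have hDs_prof : ∀ m' (j : Fin (2 * m')) (x : Γ), ∑ Y ∈ univ.filter (fun Y : Fin (2 * m') → Γ => Y j = x),
      ‖kernel 𝕜 Ds (2 * m') Y‖ ≤ E m' := by
    intro m' j x
    have hle := sum_filter_norm_kernel_supportPart_mul_le P D (2 * m') j x (fun _ => (1 : ℝ)) (fun _ => zero_le_one)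
    simp only [mul_one] at hle
    rw [← hDs] at hle
    by_cases hx : P x
    · exact hle.trans (hE m' j x hx)
    · have hze := sum_filter_norm_kernel_supportPart_eq_zero_of_not P D (2 * m') j hx (fun _ => (1 : ℝ))
      simp only [mul_one] at hze
      rw [← hDs] at hze
      rw [hze]
      exact hE0 m'
  -- the weighted profile of `Db` is `≤ N_D`
  have hDb_wprof : ∀ m' (j : Fin (2 * m')) (x : Γ), ∑ Y ∈ univ.filter (fun Y : Fin (2 * m') → Γ => Y j = x),
      ‖kernel 𝕜 Db (2 * m') Y‖ * wt (univ.image Y) ≤ ND m' := by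
    intro m' j x
    have h := (sum_filter_norm_kernel_sub_supportPart_mul_le P D (2 * m') j x (fun Y => wt (univ.image Y)) fun Y => hwt.nonneg _).trans
      (hND m' j x)
    rw [← hDb] at h
    exact h
  -- every kernel of `Db` touches the zone `Pᶜ`
  have hZ : ∀ (m' : ℕ) (Y : Fin (2 * m') → Γ), kernel 𝕜 Db (2 * m') Y ≠ 0 → ∃ j, Y j ∈ {z | ¬ P z} := fun m' Y h =>
    exists_not_of_kernel_sub_supportPart_ne_zero 𝕜 P D h
  have hΛ' : ∀ S : Finset Γ, w ∈ S → (∃ z ∈ S, z ∈ {z | ¬ P z}) → Λ ≤ wt S := fun S hS hz => hΛ S hS hz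
  -- (1) the small part: the binomial–Gram door at the unweighted profile `E`
  have hsmall := sum_norm_kernel_gaussConv_sub_le_binomial_of_gramBounded C hκ hGB Ds hDs_even E hE0 hDs_prof i w
  -- (2) the big part: the zone form at the weighted profile `N_D`, divided by `Λ`
  have hbig' := const_mul_sum_norm_kernel_gaussConv_sub_le_binomial_zone_of_gramBounded C hwt hκ hGB Db hDb_even ND hND0 hDb_wprof
    {z | ¬ P z} hZ w hΛ0.le hΛ' i
  have hbig := (le_inv_mul_iff₀ hΛ0).2 hbig'
  -- assemble
  have halg : gaussConv 𝕜 C D - D = (gaussConv 𝕜 C Ds - Ds) + (gaussConv 𝕜 C Db - Db) := by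
    conv_lhs => rw [hsplit]
    rw [map_add]; abel
  calc ∑ W ∈ univ.filter (fun W : Fin (2 * p) → Γ => W i = w), ‖kernel 𝕜 (gaussConv 𝕜 C D - D) (2 * p) W‖
      ≤ ∑ W ∈ univ.filter (fun W : Fin (2 * p) → Γ => W i = w),
          (‖kernel 𝕜 (gaussConv 𝕜 C Ds - Ds) (2 * p) W‖ + ‖kernel 𝕜 (gaussConv 𝕜 C Db - Db) (2 * p) W‖) := by
        refine sum_le_sum fun W _ => ?_
        rw [halg, kernel_add]
        exact norm_add_le _ _
    _ ≤ _ := by rw [sum_add_distrib]; exact add_le_add hsmall hbig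

end Literature.MathematicalPhysics.QuantumLattice

end
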